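import Summits.QuantumFields.BalabanUV.Beta.GAN24.CombContactRefinePThree
import Summits.QuantumFields.BalabanUV.Beta.GAN24.ContactRefinePThreePack

/-!
# `BalabanUV.Beta.GAN24.CombContactRefinePThreePack` — row G-an2-4 ∕ (CONV-C), TRANSFER-III, (III′) S-slot (b), the Wilson contact RATE END `hCTd′`, step CT-4c-P AT THE COMB CHART,
# PACKAGED: **THE (III′) P-ATOM OF THE CELLS, DIFFERENCED ACROSS TWO CONSECUTIVE TOWERS, IS `θP^k`-SMALL IN TABLE UNITS, FROM `2 ≤ Lc` ALONE, FOR EVERY ROOT PAIR** — the (III′) twin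
# of road-P2 g34's `ContactRefinePThreePack`: road-P2's `exists_refine_letters` BY NAME (the same five families), MY `CombContactRefinePThree.abs_pairingAtom_refine_le`, a NEW power
# count for MY letters (`A_P = 8LcC + F·c₁·C`, `A_d = (8Lc + F·c₁)·c`; the TWO spikes give the rows `K′·N′⁻¹`, `K′·N′⁻²`, `N′⁻¹`, `K′ = k+3`), road-P2's log absorption
# `succ_mul_inv_pow_le` at `K = k+2`.

NOT IN PRINT; OUR BOOKKEEPING (leaf prover `b2b-balaban-gan24-formalise-leaf-01` gen 89; [folklore] real algebra + packaging; 0 `def`, 0 cited facts, 0 `def … : Prop`, 0 sorry).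
HONEST FRAMING (verbatim): «discharging `BetaPertH` makes Bałaban's UV stability UNCONDITIONAL — a real constructive-QFT result; it is NOT the continuum limit and NOT the Clay problem.»
HONEST DEPENDENCY (verbatim): «continuum YM on T⁴ ⇐ BetaPertH ∧ nine spine estimates (0/9 proved); BetaPertH ⇐ (D1) ∧ (D4) ∧ CAP+tail; G-an2-4 gates asym, D1 and NE2/3/4.»
§1 `powerCount_eq ∕ powerCount_le`; §2 **`exists_pairingAtom_refine_three`**, **`exists_pairingAtomTip_refine_three`**, **`exists_pairingAtomMid_refine_three`** (every root pair `r, rr`).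
Discharges NOTHING of `hCTd′` by itself (the (III′) twins of `ContactCauchyCells ∕ Assembly` sum the atoms per cell); NEVER «G-an2-4 closed» as (CONV-C); NOT D1, NOT BetaPertH,
NOT continuum, NOT Clay.  2026-08-28; no existing file touched.
-/

noncomputable section

open Finset
open scoped BigOperators
open Literature.MathematicalPhysics.QuantumFieldTheory
open Literature.MathematicalPhysics.QuantumFieldTheory.LatticeForm (quo)
open Literature.MathematicalPhysics.QuantumFieldTheory.Balaban1983to89
open Literature.MathematicalPhysics.QuantumFieldTheory.Balaban1983to89.Beta
open B4ContourShift (supNorm supNorm_nonneg)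
open ExpKernelCalculus (Zl Zl_nonneg)
open KernelSpecInstance (wΦ)
open AffineAveraging (Form0 Form1 Site box toSite unitVec)
open AffineReproduction (contourSumAdj)
open AveragingContours (blk)
open KKTFluctuationKernel (delta1)
open BalabanCompositeJets (respStep)
open Summit.QuantumFields.BalabanUV.Beta.AxialProjectorBlockMean (bmGaugeAt)
open Summit.QuantumFields.BalabanUV.Beta.SymCorrectorFace (faceWtSum faceWtSum_nonneg)
open Summit.QuantumFields.BalabanUV.Beta.GAN24.RespStepBmDecompPsi (Psi)
open Summit.QuantumFields.BalabanUV.Beta.GAN24.ContactOneGaugeCellBound (tsum_env3_le)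
open Summit.QuantumFields.BalabanUV.Beta.GAN24.ContactRefinePWeights (succ_mul_inv_pow_le three_div_two_mul_lt_one)
open Summit.QuantumFields.BalabanUV.Beta.GAN24.CombLegChainGauge (PsiFace)
open Summit.QuantumFields.BalabanUV.Beta.GAN24.CombContactRefinePThree (abs_pairingAtom_refine_le)

namespace Summit.QuantumFields.BalabanUV.Beta.GAN24.CombContactRefinePThreePack

variable {Lc : ℕ} [NeZero Lc]

/-! ## §1 The power count -/

/-- [folklore] **THE POWER COUNT FOR THE (III′) LETTERS**: multiplied by the table currency `Lc^{12(k+2)}` and the envelope counts `N′^4`, `N^4`, the three weight bounds of MY parametric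
END are `B₁·K′·N′⁻¹ + B₂·K′·N′⁻² + B₃·N′⁻¹ + B₄·θ^k + B₅·θK^k` EXACTLY with `k`-FREE `B_i` (`K′ = (k+2)+1`, `N′ = Lc^{k+2}`) — every power of the level cancels. -/
theorem powerCount_eq {κ₀ C c θ Φ₀ cT θK F : ℝ} (k : ℕ) :
    (Lc : ℝ) ^ (12 * (k + 2)) * ((((((k + 2 : ℕ) : ℝ)) + 1) * (2 * Real.exp (2 * κ₀) * (((Lc ^ (k + 2) : ℕ) : ℝ) * (Φ₀ * ((Lc : ℝ) ^ (8 * (k + 2)))⁻¹) * Real.exp κ₀) * ((8 * (Lc : ℝ) * C + F * (1 + 8 * (Lc : ℝ) * (Real.exp κ₀ + 1)) * C) * ((Lc : ℝ) ^ (5 * (k + 2)))⁻¹) * ((8 * (Lc : ℝ) * C + F * (1 + 8 * (Lc : ℝ) * (Real.exp κ₀ + 1)) * C) * ((Lc : ℝ) ^ (5 * (k + 2)))⁻¹)) + ((((k + 2 : ℕ) : ℝ)) + 1) * (2 * Real.exp (5 * κ₀) * ((Φ₀ * ((Lc : ℝ) ^ (8 * (k + 2)))⁻¹) + (((Lc ^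 (k + 2) : ℕ) : ℝ) * (Φ₀ * ((Lc : ℝ) ^ (8 * (k + 2)))⁻¹) * Real.exp κ₀)) * ((8 * (Lc : ℝ) * C + F * (1 + 8 * (Lc : ℝ) * (Real.exp κ₀ + 1)) * C) * ((Lc : ℝ) ^ (5 * (k + 2)))⁻¹) * ((8 * (Lc : ℝ) * C + F * (1 + 8 * (Lc : ℝ) * (Real.exp κ₀ + 1)) * C) * ((Lc : ℝ) ^ (5 * (k + 2)))⁻¹))
          + 8 * Real.exp (5 * κ₀) * ((8 * (Lc : ℝ) + F * (1 + 8 * (Lc : ℝ) * (Real.exp κ₀ + 1))) * (c * θ ^ k) * ((Lc : ℝ) ^ (5 * (k + 2)))⁻¹) * ((8 * (Lc : ℝ) * C + F * (1 + 8 * (Lc : ℝ) * (Real.exp κ₀ + 1)) * C) * ((Lc : ℝ) ^ (5 * (k + 2)))⁻¹) * (Lc : ℝ) ^ (k + 2) * (2 * (((Lc ^ (k + 2) : ℕ) : ℝ) * (Φ₀ * ((Lc : ℝ) ^ (8 * (k + 2)))⁻¹) * Real.exp κ₀) + (Φ₀ * ((Lc : ℝ) ^ (8 * (k + 2)))⁻¹)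 * (Lc : ℝ) ^ (k + 2)))
        + (2 * Real.exp (5 * κ₀) * ((8 * (Lc : ℝ) * C + F * (1 + 8 * (Lc : ℝ) * (Real.exp κ₀ + 1)) * C) * ((Lc : ℝ) ^ (5 * (k + 2)))⁻¹) * ((8 * (Lc : ℝ) * C + F * (1 + 8 * (Lc : ℝ) * (Real.exp κ₀ + 1)) * C) * ((Lc : ℝ) ^ (5 * (k + 2)))⁻¹) * (((((k + 2 : ℕ) : ℝ)) + 1) * (((Lc ^ (k + 2) : ℕ) : ℝ) * (Φ₀ * ((Lc : ℝ) ^ (8 * (k + 2)))⁻¹) * Real.exp κ₀) + 2 * (Φ₀ * ((Lc : ℝ) ^ (8 * (k + 2)))⁻¹) * (Lc : ℝ) ^ (k + 2))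
          + 2 * Real.exp (5 * κ₀) * ((8 * (Lc : ℝ) * C + F * (1 + 8 * (Lc : ℝ) * (Real.exp κ₀ + 1)) * C) * ((Lc : ℝ) ^ (5 * (k + 2)))⁻¹) * ((8 * (Lc : ℝ) * C + F * (1 + 8 * (Lc : ℝ) * (Real.exp κ₀ + 1)) * C) * ((Lc : ℝ) ^ (5 * (k + 2)))⁻¹) * (((((k + 2 : ℕ) : ℝ)) + 1) * (((Lc ^ (k + 2) : ℕ) : ℝ) * (Φ₀ * ((Lc : ℝ) ^ (8 * (k + 2)))⁻¹) * Real.exp κ₀) + 2 * (Φ₀ * ((Lc : ℝ) ^ (8 * (k + 2)))⁻¹) * (Lc : ℝ) ^ (k + 2))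
          + 8 * Real.exp (5 * κ₀) * ((8 * (Lc : ℝ) * C + F * (1 + 8 * (Lc : ℝ) * (Real.exp κ₀ + 1)) * C) * ((Lc : ℝ) ^ (5 * (k + 2)))⁻¹) * ((8 * (Lc : ℝ) + F * (1 + 8 * (Lc : ℝ) * (Real.exp κ₀ + 1))) * (c * θ ^ k) * ((Lc : ℝ) ^ (5 * (k + 2)))⁻¹) * (Lc : ℝ) ^ (k + 2) * (2 * (((Lc ^ (k + 2) : ℕ) : ℝ) * (Φ₀ * ((Lc : ℝ) ^ (8 * (k + 2)))⁻¹) * Real.exp κ₀) + (Φ₀ * ((Lc : ℝ) ^ (8 * (k + 2)))⁻¹) * (Lc : ℝ) ^ (k + 2)))) * ((((Lc ^ (k + 2) : ℕ) : ℝ)) ^ (3 + 1))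
      + (Lc : ℝ) ^ (12 * (k + 2)) * (8 * Real.exp (5 * κ₀) * ((8 * (Lc : ℝ) * C + F * (1 + 8 * (Lc : ℝ) * (Real.exp κ₀ + 1)) * C) * ((Lc : ℝ) ^ (5 * (k + 1)))⁻¹) * ((8 * (Lc : ℝ) * C + F * (1 + 8 * (Lc : ℝ) * (Real.exp κ₀ + 1)) * C) * ((Lc : ℝ) ^ (5 * (k + 1)))⁻¹) * (Lc : ℝ) ^ (k + 1) * (2 * (((Lc ^ (k + 1) : ℕ) : ℝ) * ((cT * θK ^ k) * ((Lc : ℝ) ^ 4 * ((Lc : ℝ) ^ (k + 2)) ^ 8)⁻¹) * Real.exp κ₀) + ((cT * θK ^ k) * ((Lc : ℝ) ^ 4 * ((Lc : ℝ) ^ (k + 2)) ^ 8)⁻¹) * (Lc : ℝ) ^ (k + 1))) * ((((Lc ^ (k + 1) : ℕ) : ℝ)) ^ (3 + 1))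
    = (Φ₀ * (8 * (Lc : ℝ) * C + F * (1 + 8 * (Lc : ℝ) * (Real.exp κ₀ + 1)) * C) ^ 2 * (2 * (Real.exp (2 * κ₀) * Real.exp κ₀) + 6 * (Real.exp (5 * κ₀) * Real.exp κ₀))) * (((((k + 2 : ℕ) : ℝ)) + 1) * (((Lc : ℝ) ^ (k + 2)))⁻¹)
      + (2 * Real.exp (5 * κ₀) * Φ₀ * (8 * (Lc : ℝ) * C + F * (1 + 8 * (Lc : ℝ) * (Real.exp κ₀ + 1)) * C) ^ 2) * (((((k + 2 : ℕ) : ℝ)) + 1) * ((((Lc : ℝ) ^ (k + 2)))⁻¹ * (((Lc : ℝ) ^ (k + 2)))⁻¹))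
      + (8 * Real.exp (5 * κ₀) * Φ₀ * (8 * (Lc : ℝ) * C + F * (1 + 8 * (Lc : ℝ) * (Real.exp κ₀ + 1)) * C) ^ 2) * (((Lc : ℝ) ^ (k + 2)))⁻¹
      + (16 * Real.exp (5 * κ₀) * (2 * Real.exp κ₀ + 1) * Φ₀ * (8 * (Lc : ℝ) * C + F * (1 + 8 * (Lc : ℝ) * (Real.exp κ₀ + 1)) * C) * ((8 * (Lc : ℝ) + F * (1 + 8 * (Lc : ℝ) * (Real.exp κ₀ + 1))) * c)) * θ ^ k
      + (8 * Real.exp (5 * κ₀) * (2 * Real.exp κ₀ + 1) * cT * (8 * (Lc : ℝ) * C + F * (1 + 8 * (Lc : ℝ) * (Real.exp κ₀ + 1)) * C) ^ 2) * θK ^ k := by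
  have hL0 : (Lc : ℝ) ≠ 0 := by exact_mod_cast NeZero.ne Lc
  have hx2 : (((Lc ^ (k + 2) : ℕ) : ℝ)) = (Lc : ℝ) ^ 2 * (Lc : ℝ) ^ k := by push_cast; ring
  have hx1 : (((Lc ^ (k + 1) : ℕ) : ℝ)) = (Lc : ℝ) * (Lc : ℝ) ^ k := by push_cast; ring
  have p2 : (Lc : ℝ) ^ (k + 2) = (Lc : ℝ) ^ 2 * (Lc : ℝ) ^ k := by ring
  have p1 : (Lc : ℝ) ^ (k + 1) = (Lc : ℝ) * (Lc : ℝ) ^ k := by ring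
  have e5 : (Lc : ℝ) ^ (5 * (k + 2)) = ((Lc : ℝ) ^ 2 * (Lc : ℝ) ^ k) ^ 5 := by rw [← p2, ← pow_mul, mul_comm]
  have e8 : (Lc : ℝ) ^ (8 * (k + 2)) = ((Lc : ℝ) ^ 2 * (Lc : ℝ) ^ k) ^ 8 := by rw [← p2, ← pow_mul, mul_comm]
  have e12 : (Lc : ℝ) ^ (12 * (k + 2)) = ((Lc : ℝ) ^ 2 * (Lc : ℝ) ^ k) ^ 12 := by rw [← p2, ← pow_mul, mul_comm]
  have e51 : (Lc : ℝ) ^ (5 * (k + 1)) = ((Lc : ℝ) * (Lc : ℝ) ^ k) ^ 5 := by rw [← p1, ← pow_mul, mul_comm]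
  have hy : (Lc : ℝ) ^ k ≠ 0 := pow_ne_zero _ hL0
  rw [hx2, hx1, p2, p1, e5, e8, e12, e51]
  push_cast
  field_simp
  ring

omit [NeZero Lc] in
/-- [folklore] The bound of the power count: `K′·N′⁻¹ ≤ 2·ρ^k`, `K′·N′⁻² ≤ 2·ρ^k`, `N′⁻¹ ≤ 2·ρ^k` (`ρ = 3∕(2Lc)`, road-P2's `succ_mul_inv_pow_le` at `K = k+2`), `θ^k, θK^k, ρ^k ≤ θP^k`
⟹ `≤ K₀·θP^k`. -/
theorem powerCount_le {κ₀ C c θ Φ₀ cT θK θP F : ℝ} (hLc : 2 ≤ Lc) (hC : 0 ≤ C) (hc : 0 ≤ c) (hθ0 : 0 ≤ θ) (hΦ : 0 ≤ Φ₀) (hcT : 0 ≤ cT)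
    (hθK0 : 0 ≤ θK) (hF : 0 ≤ F) (hθle : θ ≤ θP) (hθKle : θK ≤ θP) (hρle : (3 : ℝ) / (2 * Lc) ≤ θP) (k : ℕ) :
    (Φ₀ * (8 * (Lc : ℝ) * C + F * (1 + 8 * (Lc : ℝ) * (Real.exp κ₀ + 1)) * C) ^ 2 * (2 * (Real.exp (2 * κ₀) * Real.exp κ₀) + 6 * (Real.exp (5 * κ₀) * Real.exp κ₀))) * (((((k + 2 : ℕ) : ℝ)) + 1) * (((Lc : ℝ) ^ (k + 2)))⁻¹)
      + (2 * Real.exp (5 * κ₀) * Φ₀ * (8 * (Lc : ℝ) * C + F * (1 + 8 * (Lc : ℝ) * (Real.exp κ₀ + 1)) * C) ^ 2) * (((((k + 2 : ℕ) : ℝ)) + 1) * ((((Lc : ℝ) ^ (k + 2)))⁻¹ * (((Lc : ℝ) ^ (k + 2)))⁻¹))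
      + (8 * Real.exp (5 * κ₀) * Φ₀ * (8 * (Lc : ℝ) * C + F * (1 + 8 * (Lc : ℝ) * (Real.exp κ₀ + 1)) * C) ^ 2) * (((Lc : ℝ) ^ (k + 2)))⁻¹
      + (16 * Real.exp (5 * κ₀) * (2 * Real.exp κ₀ + 1) * Φ₀ * (8 * (Lc : ℝ) * C + F * (1 + 8 * (Lc : ℝ) * (Real.exp κ₀ + 1)) * C) * ((8 * (Lc : ℝ) + F * (1 + 8 * (Lc : ℝ) * (Real.exp κ₀ + 1))) * c)) * θ ^ k
      + (8 * Real.exp (5 * κ₀) * (2 * Real.exp κ₀ + 1) * cT * (8 * (Lc : ℝ) * C + F * (1 + 8 * (Lc : ℝ) * (Real.exp κ₀ + 1)) * C) ^ 2) * θK ^ k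
    ≤ (2 * (Φ₀ * (8 * (Lc : ℝ) * C + F * (1 + 8 * (Lc : ℝ) * (Real.exp κ₀ + 1)) * C) ^ 2 * (2 * (Real.exp (2 * κ₀) * Real.exp κ₀) + 6 * (Real.exp (5 * κ₀) * Real.exp κ₀))) + 2 * (2 * Real.exp (5 * κ₀) * Φ₀ * (8 * (Lc : ℝ) * C + F * (1 + 8 * (Lc : ℝ) * (Real.exp κ₀ + 1)) * C) ^ 2) + 2 * (8 * Real.exp (5 * κ₀) * Φ₀ * (8 * (Lc : ℝ) * C + F * (1 + 8 * (Lc : ℝ) * (Real.exp κ₀ + 1)) * C) ^ 2) + (16 * Real.exp (5 * κ₀) * (2 * Real.exp κ₀ + 1) * Φ₀ * (8 * (Lc : ℝ) * C + F * (1 + 8 * (Lc : ℝ) * (Real.exp κ₀ + 1)) * C) * ((8 * (Lc : ℝ) + F * (1 + 8 * (Lc : ℝ) * (Real.exp κ₀ + 1))) * c)) + (8 * Real.exp (5 * κ₀) * (2 * Real.exp κ₀ + 1) * cT * (8 * (Lc : ℝ) * C + F * (1 + 8 * (Lc : ℝ) * (Real.exp κ₀ + 1)) * C) ^ 2)) *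 θP ^ k := by
  obtain ⟨hρ0, hρ1⟩ := three_div_two_mul_lt_one hLc
  have hL0 : (0 : ℝ) < (Lc : ℝ) := by exact_mod_cast (show 0 < Lc by omega)
  have hL1 : (1 : ℝ) ≤ (Lc : ℝ) := by exact_mod_cast (show 1 ≤ Lc by omega)
  have hN1 : (1 : ℝ) ≤ (Lc : ℝ) ^ (k + 2) := one_le_pow₀ hL1
  have hNinv : (((Lc : ℝ) ^ (k + 2)))⁻¹ ≤ 1 := inv_le_one_of_one_le₀ hN1
  have hNinv0 : 0 ≤ (((Lc : ℝ) ^ (k + 2)))⁻¹ := by positivity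
  have hq : ((((k + 2 : ℕ) : ℝ)) + 1) * (((Lc : ℝ) ^ (k + 2)))⁻¹ ≤ 2 * ((3 : ℝ) / (2 * Lc)) ^ k := by
    have h := succ_mul_inv_pow_le (Lc := Lc) (by omega) (k + 2)
    refine h.trans ?_
    rw [pow_succ, pow_succ]
    nlinarith [pow_nonneg hρ0 k, mul_nonneg (pow_nonneg hρ0 k) hρ0]
  have hq2 : ((((k + 2 : ℕ) : ℝ)) + 1) * ((((Lc : ℝ) ^ (k + 2)))⁻¹ * (((Lc : ℝ) ^ (k + 2)))⁻¹) ≤ 2 * ((3 : ℝ) / (2 * Lc)) ^ k := by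
    refine le_trans ?_ hq
    have hK0 : 0 ≤ ((((k + 2 : ℕ) : ℝ)) + 1) := by positivity
    calc ((((k + 2 : ℕ) : ℝ)) + 1) * ((((Lc : ℝ) ^ (k + 2)))⁻¹ * (((Lc : ℝ) ^ (k + 2)))⁻¹)
        ≤ ((((k + 2 : ℕ) : ℝ)) + 1) * ((((Lc : ℝ) ^ (k + 2)))⁻¹ * 1) := mul_le_mul_of_nonneg_left (mul_le_mul_of_nonneg_left hNinv hNinv0) hK0
      _ = _ := by rw [mul_one]
  have hr : (((Lc : ℝ) ^ (k + 2)))⁻¹ ≤ 2 * ((3 : ℝ) / (2 * Lc)) ^ k := by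
    refine le_trans ?_ hq
    have h1 : (1 : ℝ) ≤ ((((k + 2 : ℕ) : ℝ)) + 1) := by push_cast; linarith [(Nat.cast_nonneg k : (0:ℝ) ≤ k)]
    nlinarith
  have hθk : θ ^ k ≤ θP ^ k := pow_le_pow_left₀ hθ0 hθle k
  have hθKk : θK ^ k ≤ θP ^ k := pow_le_pow_left₀ hθK0 hθKle k
  have hρk : ((3 : ℝ) / (2 * Lc)) ^ k ≤ θP ^ k := pow_le_pow_left₀ hρ0 hρle k
  have hA1 : 0 ≤ (Φ₀ * (8 * (Lc : ℝ) * C + F * (1 + 8 * (Lc : ℝ) * (Real.exp κ₀ + 1)) * C) ^ 2 * (2 * (Real.exp (2 * κ₀) * Real.exp κ₀) + 6 * (Real.exp (5 * κ₀) * Real.exp κ₀))) := by positivity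
  have hA2 : 0 ≤ (2 * Real.exp (5 * κ₀) * Φ₀ * (8 * (Lc : ℝ) * C + F * (1 + 8 * (Lc : ℝ) * (Real.exp κ₀ + 1)) * C) ^ 2) := by positivity
  have hA3 : 0 ≤ (8 * Real.exp (5 * κ₀) * Φ₀ * (8 * (Lc : ℝ) * C + F * (1 + 8 * (Lc : ℝ) * (Real.exp κ₀ + 1)) * C) ^ 2) := by positivity
  have hA4 : 0 ≤ (16 * Real.exp (5 * κ₀) * (2 * Real.exp κ₀ + 1) * Φ₀ * (8 * (Lc : ℝ) * C + F * (1 + 8 * (Lc : ℝ) * (Real.exp κ₀ + 1)) * C) * ((8 * (Lc : ℝ) + F * (1 + 8 * (Lc : ℝ) * (Real.exp κ₀ + 1))) * c)) := by positivity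
  have hA5 : 0 ≤ (8 * Real.exp (5 * κ₀) * (2 * Real.exp κ₀ + 1) * cT * (8 * (Lc : ℝ) * C + F * (1 + 8 * (Lc : ℝ) * (Real.exp κ₀ + 1)) * C) ^ 2) := by positivity
  have t1 := mul_le_mul_of_nonneg_left (hq.trans (mul_le_mul_of_nonneg_left hρk (by norm_num))) hA1
  have t2 := mul_le_mul_of_nonneg_left (hq2.trans (mul_le_mul_of_nonneg_left hρk (by norm_num))) hA2
  have t3 := mul_le_mul_of_nonneg_left (hr.trans (mul_le_mul_of_nonneg_left hρk (by norm_num))) hA3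
  have t4 := mul_le_mul_of_nonneg_left hθk hA4
  have t5 := mul_le_mul_of_nonneg_left hθKk hA5
  linarith [t1, t2, t3, t4, t5]

/-! ## §2 The packaged ENDs -/

set_option maxHeartbeats 1000000 in  -- the displayed letters are large terms (two-spike weights with the face letter `F`)
/-- NOT IN PRINT; OUR BOOKKEEPING.  **CT-4c SHAPE P at `d = 3` AT THE COMB CHART, PACKAGED — THE (III′) P-ATOM, DIFFERENCED ACROSS TWO CONSECUTIVE TOWERS, IS `θP^k`-SMALL IN TABLE UNITS**
(every `Lc ≥ 2`, every root pair `r, rr ∈ box`, NO hypothesis): ONE rate `κ₀ > 0`, ONE `K ≥ 0`, ONE `θP ∈ [0,1)` with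
`|Lc^{12(k+2)}·atom′_{k+1} − Lc^{12(k+1)}·atom_k| ≤ K·θP^k·e^{−(κ₀∕12)(‖z₁ − zt‖∞ + ‖z₂ − zt‖∞)}` (`λ′^{(0,·)}` the conjugated bond gauge functions, as in `CombContactRefinePThree`). -/
theorem exists_pairingAtom_refine_three (hLc : 2 ≤ Lc) :
    ∃ κ₀ K θP : ℝ, 0 < κ₀ ∧ 0 ≤ K ∧ 0 ≤ θP ∧ θP < 1 ∧
      ∀ (r : Fin (3 + 1) → ℕ), r ∈ box (3 + 1) Lc → ∀ (rr : Fin (3 + 1) → ℕ), rr ∈ box (3 + 1) Lc →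
        ∀ (k : ℕ) (μt : Fin (3 + 1)) (zt : Site (3 + 1)) (μ₁ : Fin (3 + 1)) (z₁ : Site (3 + 1)) (μ₂ : Fin (3 + 1)) (z₂ : Site (3 + 1))
          (θ₀ θ₁ : ℝ), |θ₀| + |θ₁| ≤ 1 → ∀ (κ : Fin (3 + 1)),
          |(Lc : ℝ) ^ (12 * (k + 2)) * (∑' v : Site (3 + 1), contourSumAdj (Lc ^ (k + 2)) (fun κ' y => wΦ (N := Lc ^ (k + 2)) κ' μt (y - zt)) κ v
            * (θ₀ * (Psi (toSite rr) Lc 0 (k + 1) (delta1 μ₁ z₁) v + PsiFace r (toSite rr) Lc 0 (k + 1) (delta1 μ₁ z₁) v - bmGaugeAt (toSite rr) (respStep (d := 3) 1 (Lc ^ (k + 2)) μ₁ z₁) Lc v)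
              + θ₁ * (Psi (toSite rr) Lc 0 (k + 1) (delta1 μ₁ z₁) (v + unitVec κ) + PsiFace r (toSite rr) Lc 0 (k + 1) (delta1 μ₁ z₁) (v + unitVec κ) - bmGaugeAt (toSite rr) (respStep (d := 3) 1 (Lc ^ (k + 2)) μ₁ z₁) Lc (v + unitVec κ)))
            * ((Psi (toSite rr) Lc 0 (k + 1) (delta1 μ₂ z₂) (v + unitVec κ) + PsiFace r (toSite rr) Lc 0 (k + 1) (delta1 μ₂ z₂) (v + unitVec κ) - bmGaugeAt (toSite rr) (respStep (d := 3) 1 (Lc ^ (k + 2)) μ₂ z₂) Lc (v + unitVec κ))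
              - (Psi (toSite rr) Lc 0 (k + 1) (delta1 μ₂ z₂) v + PsiFace r (toSite rr) Lc 0 (k + 1) (delta1 μ₂ z₂) v - bmGaugeAt (toSite rr) (respStep (d := 3) 1 (Lc ^ (k + 2)) μ₂ z₂) Lc v)))
            - (Lc : ℝ) ^ (12 * (k + 1)) * (∑' w : Site (3 + 1), contourSumAdj (Lc ^ (k + 1)) (fun κ' y => wΦ (N := Lc ^ (k + 1)) κ' μt (y - zt)) κ w
            * (θ₀ * (Psi (toSite rr) Lc 0 k (delta1 μ₁ z₁) w + PsiFace r (toSite rr) Lc 0 k (delta1 μ₁ z₁) w - bmGaugeAt (toSite rr) (respStep (d := 3) 1 (Lc ^ (k + 1)) μ₁ z₁) Lc w)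
              + θ₁ * (Psi (toSite rr) Lc 0 k (delta1 μ₁ z₁) (w + unitVec κ) + PsiFace r (toSite rr) Lc 0 k (delta1 μ₁ z₁) (w + unitVec κ) - bmGaugeAt (toSite rr) (respStep (d := 3) 1 (Lc ^ (k + 1)) μ₁ z₁) Lc (w + unitVec κ)))
            * ((Psi (toSite rr) Lc 0 k (delta1 μ₂ z₂) (w + unitVec κ) + PsiFace r (toSite rr) Lc 0 k (delta1 μ₂ z₂) (w + unitVec κ) - bmGaugeAt (toSite rr) (respStep (d := 3) 1 (Lc ^ (k + 1)) μ₂ z₂) Lc (w + unitVec κ))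
              - (Psi (toSite rr) Lc 0 k (delta1 μ₂ z₂) w + PsiFace r (toSite rr) Lc 0 k (delta1 μ₂ z₂) w - bmGaugeAt (toSite rr) (respStep (d := 3) 1 (Lc ^ (k + 1)) μ₂ z₂) Lc w)))|
            ≤ K * θP ^ k * Real.exp (-(κ₀ / 12) * (supNorm (z₁ - zt) + supNorm (z₂ - zt))) := by
  obtain ⟨κ₀, C, c, θ, Φ₀, cT, θK, hκ, hC, hc, hθ0, hθ1, hΦ, hcT, hθK0, hθK1, hN1, hCau, hΦenv, ht, hTd⟩ := ContactRefinePThreePack.exists_refine_letters (Lc := Lc) hLc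
  obtain ⟨hρ0, hρ1⟩ := three_div_two_mul_lt_one hLc
  have hL0 : (0 : ℝ) < (Lc : ℝ) := by exact_mod_cast (show 0 < Lc by omega)
  set F : ℝ := ∑ r' ∈ box (3 + 1) Lc, faceWtSum r' Lc with hFdef
  have hF0 : 0 ≤ F := Finset.sum_nonneg fun r' _ => faceWtSum_nonneg r' Lc
  have hθP0 : 0 ≤ max θ (max θK ((3 : ℝ) / (2 * Lc))) := hθ0.trans (le_max_left _ _)
  have hθP1 : max θ (max θK ((3 : ℝ) / (2 * Lc))) < 1 := max_lt hθ1 (max_lt hθK1 hρ1)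
  have hθle : θ ≤ max θ (max θK ((3 : ℝ) / (2 * Lc))) := le_max_left _ _
  have hθKle : θK ≤ max θ (max θK ((3 : ℝ) / (2 * Lc))) := (le_max_left _ _).trans (le_max_right _ _)
  have hρle : (3 : ℝ) / (2 * Lc) ≤ max θ (max θK ((3 : ℝ) / (2 * Lc))) := (le_max_right _ _).trans (le_max_right _ _)
  have hZ0 : 0 ≤ Zl (3 + 1) (κ₀ / (4 * (((3 : ℕ) : ℝ) + 1))) := Zl_nonneg (by positivity)
  have hK₀0 : 0 ≤ (2 * (Φ₀ * (8 * (Lc : ℝ) * C + F * (1 + 8 * (Lc : ℝ) * (Real.exp κ₀ + 1)) * C) ^ 2 * (2 * (Real.exp (2 * κ₀) * Real.exp κ₀) + 6 * (Real.exp (5 * κ₀) * Real.exp κ₀))) + 2 * (2 * Real.exp (5 * κ₀) * Φ₀ * (8 * (Lc : ℝ) * C + F * (1 + 8 * (Lc : ℝ) * (Real.exp κ₀ + 1)) * C) ^ 2) + 2 * (8 * Real.exp (5 * κ₀) * Φ₀ * (8 * (Lc : ℝ) * C + F * (1 + 8 * (Lc : ℝ) * (Real.exp κ₀ + 1)) *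 C) ^ 2) + (16 * Real.exp (5 * κ₀) * (2 * Real.exp κ₀ + 1) * Φ₀ * (8 * (Lc : ℝ) * C + F * (1 + 8 * (Lc : ℝ) * (Real.exp κ₀ + 1)) * C) * ((8 * (Lc : ℝ) + F * (1 + 8 * (Lc : ℝ) * (Real.exp κ₀ + 1))) * c)) + (8 * Real.exp (5 * κ₀) * (2 * Real.exp κ₀ + 1) * cT * (8 * (Lc : ℝ) * C + F * (1 + 8 * (Lc : ℝ) * (Real.exp κ₀ + 1)) * C) ^ 2)) := by positivity
  refine ⟨κ₀, (2 * (Φ₀ * (8 * (Lc : ℝ) * C + F * (1 + 8 * (Lc : ℝ) * (Real.exp κ₀ + 1)) * C) ^ 2 * (2 * (Real.exp (2 * κ₀) * Real.exp κ₀) + 6 * (Real.exp (5 * κ₀) * Real.exp κ₀))) + 2 * (2 * Real.exp (5 * κ₀) * Φ₀ * (8 * (Lc : ℝ) * C + F * (1 + 8 * (Lc : ℝ) * (Real.exp κ₀ + 1)) * C) ^ 2) + 2 * (8 * Real.exp (5 * κ₀) * Φ₀ * (8 * (Lc : ℝ) * C + F * (1 + 8 * (Lc : ℝ) * (Real.exp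 κ₀ + 1)) * C) ^ 2) + (16 * Real.exp (5 * κ₀) * (2 * Real.exp κ₀ + 1) * Φ₀ * (8 * (Lc : ℝ) * C + F * (1 + 8 * (Lc : ℝ) * (Real.exp κ₀ + 1)) * C) * ((8 * (Lc : ℝ) + F * (1 + 8 * (Lc : ℝ) * (Real.exp κ₀ + 1))) * c)) + (8 * Real.exp (5 * κ₀) * (2 * Real.exp κ₀ + 1) * cT * (8 * (Lc : ℝ) * C + F * (1 + 8 * (Lc : ℝ) * (Real.exp κ₀ + 1)) * C) ^ 2)) * Zl (3 + 1) (κ₀ / (4 * (((3 : ℕ) : ℝ) + 1))), max θ (max θK ((3 : ℝ) / (2 * Lc))), hκ, by positivity, hθP0, hθP1,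
    fun r hr rr hrr k μt zt μ₁ z₁ μ₂ z₂ θ₀ θ₁ hθr κ => ?_⟩
  have hFr : faceWtSum r Lc ≤ F := Finset.single_le_sum (fun r' _ => faceWtSum_nonneg r' Lc) hr
  have hN1' : 1 ≤ Lc ^ (k + 1) := Nat.one_le_pow _ _ (by omega)
  have hN2' : 1 ≤ Lc ^ (k + 2) := Nat.one_le_pow _ _ (by omega)
  have hA := abs_pairingAtom_refine_le (Lc := Lc) hLc hr hrr hFr hκ hC hc hθ0 hΦ hN1 hCau hΦenv ht k μt zt (hTd k μt zt) μ₁ z₁ μ₂ z₂ hθr κ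
  -- table units
  have e12 : (Lc : ℝ) ^ (12 * (k + 1)) = (Lc : ℝ) ^ (12 * (k + 2)) * ((Lc : ℝ) ^ 12)⁻¹ := by
    rw [show 12 * (k + 2) = 12 * (k + 1) + 12 by ring, pow_add, mul_assoc, mul_inv_cancel₀ (pow_ne_zero _ hL0.ne'), mul_one]
  have h12 : (0 : ℝ) < (Lc : ℝ) ^ (12 * (k + 2)) := pow_pos hL0 _
  rw [e12, mul_assoc, ← mul_sub, abs_mul, abs_of_pos h12]
  refine (mul_le_mul_of_nonneg_left hA h12.le).trans ?_
  -- the two envelope series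
  obtain ⟨-, hS'⟩ := tsum_env3_le (d := 3) (L := Lc ^ (k + 2)) hN2' hκ zt z₁ z₂
  obtain ⟨-, hS⟩ := tsum_env3_le (d := 3) (L := Lc ^ (k + 1)) hN1' hκ zt z₁ z₂
  have hB12 : 0 ≤ (((((k + 2 : ℕ) : ℝ)) + 1) * (2 * Real.exp (2 * κ₀) * (((Lc ^ (k + 2) : ℕ) : ℝ) * (Φ₀ * ((Lc : ℝ) ^ (8 * (k + 2)))⁻¹) * Real.exp κ₀) * ((8 * (Lc : ℝ) * C + F * (1 + 8 * (Lc : ℝ) * (Real.exp κ₀ + 1)) * C) * ((Lc : ℝ) ^ (5 * (k + 2)))⁻¹) * ((8 * (Lc : ℝ) * C + F * (1 + 8 * (Lc : ℝ) * (Real.exp κ₀ + 1)) * C) * ((Lc : ℝ) ^ (5 * (k + 2)))⁻¹)) + ((((k + 2 : ℕ) : ℝ)) + 1) * (2 * Real.exp (5 * κ₀) * ((Φ₀ * ((Lc : ℝ) ^ (8 * (k + 2)))⁻¹) + (((Lc ^ (k + 2) : ℕ) : ℝ) * (Φ₀ * ((Lc : ℝ) ^ (8 * (k + 2)))⁻¹)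 * Real.exp κ₀)) * ((8 * (Lc : ℝ) * C + F * (1 + 8 * (Lc : ℝ) * (Real.exp κ₀ + 1)) * C) * ((Lc : ℝ) ^ (5 * (k + 2)))⁻¹) * ((8 * (Lc : ℝ) * C + F * (1 + 8 * (Lc : ℝ) * (Real.exp κ₀ + 1)) * C) * ((Lc : ℝ) ^ (5 * (k + 2)))⁻¹))
          + 8 * Real.exp (5 * κ₀) * ((8 * (Lc : ℝ) + F * (1 + 8 * (Lc : ℝ) * (Real.exp κ₀ + 1))) * (c * θ ^ k) * ((Lc : ℝ) ^ (5 * (k + 2)))⁻¹) * ((8 * (Lc : ℝ) * C + F * (1 + 8 * (Lc : ℝ) * (Real.exp κ₀ + 1)) * C) * ((Lc : ℝ) ^ (5 * (k + 2)))⁻¹) * (Lc : ℝ) ^ (k + 2) * (2 * (((Lc ^ (k + 2) : ℕ) : ℝ) * (Φ₀ * ((Lc : ℝ) ^ (8 * (k + 2)))⁻¹) * Real.exp κ₀) + (Φ₀ * ((Lc : ℝ) ^ (8 * (k + 2)))⁻¹) * (Lc : ℝ) ^ (k + 2)))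
        + (2 * Real.exp (5 * κ₀) * ((8 * (Lc : ℝ) * C + F * (1 + 8 * (Lc : ℝ) * (Real.exp κ₀ + 1)) * C) * ((Lc : ℝ) ^ (5 * (k + 2)))⁻¹) * ((8 * (Lc : ℝ) * C + F * (1 + 8 * (Lc : ℝ) * (Real.exp κ₀ + 1)) * C) * ((Lc : ℝ) ^ (5 * (k + 2)))⁻¹) * (((((k + 2 : ℕ) : ℝ)) + 1) * (((Lc ^ (k + 2) : ℕ) : ℝ) * (Φ₀ * ((Lc : ℝ) ^ (8 * (k + 2)))⁻¹) * Real.exp κ₀) + 2 * (Φ₀ * ((Lc : ℝ) ^ (8 * (k + 2)))⁻¹) * (Lc : ℝ) ^ (k + 2))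
          + 2 * Real.exp (5 * κ₀) * ((8 * (Lc : ℝ) * C + F * (1 + 8 * (Lc : ℝ) * (Real.exp κ₀ + 1)) * C) * ((Lc : ℝ) ^ (5 * (k + 2)))⁻¹) * ((8 * (Lc : ℝ) * C + F * (1 + 8 * (Lc : ℝ) * (Real.exp κ₀ + 1)) * C) * ((Lc : ℝ) ^ (5 * (k + 2)))⁻¹) * (((((k + 2 : ℕ) : ℝ)) + 1) * (((Lc ^ (k + 2) : ℕ) : ℝ) * (Φ₀ * ((Lc : ℝ) ^ (8 * (k + 2)))⁻¹) * Real.exp κ₀) + 2 * (Φ₀ * ((Lc : ℝ) ^ (8 * (k + 2)))⁻¹) * (Lc : ℝ) ^ (k + 2))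
          + 8 * Real.exp (5 * κ₀) * ((8 * (Lc : ℝ) * C + F * (1 + 8 * (Lc : ℝ) * (Real.exp κ₀ + 1)) * C) * ((Lc : ℝ) ^ (5 * (k + 2)))⁻¹) * ((8 * (Lc : ℝ) + F * (1 + 8 * (Lc : ℝ) * (Real.exp κ₀ + 1))) * (c * θ ^ k) * ((Lc : ℝ) ^ (5 * (k + 2)))⁻¹) * (Lc : ℝ) ^ (k + 2) * (2 * (((Lc ^ (k + 2) : ℕ) : ℝ) * (Φ₀ * ((Lc : ℝ) ^ (8 * (k + 2)))⁻¹) * Real.exp κ₀) + (Φ₀ * ((Lc : ℝ) ^ (8 * (k + 2)))⁻¹) * (Lc : ℝ) ^ (k + 2))) := by positivity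
  have hB3 : 0 ≤ (8 * Real.exp (5 * κ₀) * ((8 * (Lc : ℝ) * C + F * (1 + 8 * (Lc : ℝ) * (Real.exp κ₀ + 1)) * C) * ((Lc : ℝ) ^ (5 * (k + 1)))⁻¹) * ((8 * (Lc : ℝ) * C + F * (1 + 8 * (Lc : ℝ) * (Real.exp κ₀ + 1)) * C) * ((Lc : ℝ) ^ (5 * (k + 1)))⁻¹) * (Lc : ℝ) ^ (k + 1) * (2 * (((Lc ^ (k + 1) : ℕ) : ℝ) * ((cT * θK ^ k) * ((Lc : ℝ) ^ 4 * ((Lc : ℝ) ^ (k + 2)) ^ 8)⁻¹) * Real.exp κ₀) + ((cT * θK ^ k) * ((Lc : ℝ) ^ 4 * ((Lc : ℝ) ^ (k + 2)) ^ 8)⁻¹) * (Lc : ℝ) ^ (k + 1))) := by positivity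
  have hstep := add_le_add (mul_le_mul_of_nonneg_left hS' hB12) (mul_le_mul_of_nonneg_left hS hB3)
  refine (mul_le_mul_of_nonneg_left hstep h12.le).trans ?_
  -- the power count
  have hcount := (powerCount_eq (Lc := Lc) (κ₀ := κ₀) (C := C) (c := c) (θ := θ) (Φ₀ := Φ₀) (cT := cT) (θK := θK) (F := F) k).trans_le
    (powerCount_le (Lc := Lc) hLc hC hc hθ0 hΦ hcT hθK0 hF0 hθle hθKle hρle k)
  have hE0 : 0 ≤ Real.exp (-(κ₀ / 12) * (supNorm (z₁ - zt) + supNorm (z₂ - zt))) := (Real.exp_pos _).le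
  calc (Lc : ℝ) ^ (12 * (k + 2)) * (((((((k + 2 : ℕ) : ℝ)) + 1) * (2 * Real.exp (2 * κ₀) * (((Lc ^ (k + 2) : ℕ) : ℝ) * (Φ₀ * ((Lc : ℝ) ^ (8 * (k + 2)))⁻¹) * Real.exp κ₀) * ((8 * (Lc : ℝ) * C + F * (1 + 8 * (Lc : ℝ) * (Real.exp κ₀ + 1)) * C) * ((Lc : ℝ) ^ (5 * (k + 2)))⁻¹) * ((8 * (Lc : ℝ) * C + F * (1 + 8 * (Lc : ℝ) * (Real.exp κ₀ + 1)) * C) * ((Lc : ℝ) ^ (5 * (k + 2)))⁻¹)) + ((((k + 2 : ℕ) : ℝ)) + 1) * (2 * Real.exp (5 * κ₀) * ((Φ₀ * ((Lc : ℝ) ^ (8 * (k + 2)))⁻¹) + (((Lc ^ (k + 2) : ℕ) : ℝ) * (Φ₀ * ((Lc : ℝ) ^ (8 * (k + 2)))⁻¹) * Real.exp κ₀)) * ((8 * (Lc : ℝ) * C + F * (1 + 8 * (Lc : ℝ) * (Real.exp κ₀ + 1)) * C) * ((Lc : ℝ) ^ (5 * (k + 2)))⁻¹) * ((8 * (Lc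 : ℝ) * C + F * (1 + 8 * (Lc : ℝ) * (Real.exp κ₀ + 1)) * C) * ((Lc : ℝ) ^ (5 * (k + 2)))⁻¹))
          + 8 * Real.exp (5 * κ₀) * ((8 * (Lc : ℝ) + F * (1 + 8 * (Lc : ℝ) * (Real.exp κ₀ + 1))) * (c * θ ^ k) * ((Lc : ℝ) ^ (5 * (k + 2)))⁻¹) * ((8 * (Lc : ℝ) * C + F * (1 + 8 * (Lc : ℝ) * (Real.exp κ₀ + 1)) * C) * ((Lc : ℝ) ^ (5 * (k + 2)))⁻¹) * (Lc : ℝ) ^ (k + 2) * (2 * (((Lc ^ (k + 2) : ℕ) : ℝ) * (Φ₀ * ((Lc : ℝ) ^ (8 * (k + 2)))⁻¹) * Real.exp κ₀) + (Φ₀ * ((Lc : ℝ) ^ (8 * (k + 2)))⁻¹) * (Lc : ℝ) ^ (k + 2)))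
        + (2 * Real.exp (5 * κ₀) * ((8 * (Lc : ℝ) * C + F * (1 + 8 * (Lc : ℝ) * (Real.exp κ₀ + 1)) * C) * ((Lc : ℝ) ^ (5 * (k + 2)))⁻¹) * ((8 * (Lc : ℝ) * C + F * (1 + 8 * (Lc : ℝ) * (Real.exp κ₀ + 1)) * C) * ((Lc : ℝ) ^ (5 * (k + 2)))⁻¹) * (((((k + 2 : ℕ) : ℝ)) + 1) * (((Lc ^ (k + 2) : ℕ) : ℝ) * (Φ₀ * ((Lc : ℝ) ^ (8 * (k + 2)))⁻¹) * Real.exp κ₀) + 2 * (Φ₀ * ((Lc : ℝ) ^ (8 * (k + 2)))⁻¹) * (Lc : ℝ) ^ (k + 2))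
          + 2 * Real.exp (5 * κ₀) * ((8 * (Lc : ℝ) * C + F * (1 + 8 * (Lc : ℝ) * (Real.exp κ₀ + 1)) * C) * ((Lc : ℝ) ^ (5 * (k + 2)))⁻¹) * ((8 * (Lc : ℝ) * C + F * (1 + 8 * (Lc : ℝ) * (Real.exp κ₀ + 1)) * C) * ((Lc : ℝ) ^ (5 * (k + 2)))⁻¹) * (((((k + 2 : ℕ) : ℝ)) + 1) * (((Lc ^ (k + 2) : ℕ) : ℝ) * (Φ₀ * ((Lc : ℝ) ^ (8 * (k + 2)))⁻¹) * Real.exp κ₀) + 2 * (Φ₀ * ((Lc : ℝ) ^ (8 * (k + 2)))⁻¹) * (Lc : ℝ) ^ (k + 2))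
          + 8 * Real.exp (5 * κ₀) * ((8 * (Lc : ℝ) * C + F * (1 + 8 * (Lc : ℝ) * (Real.exp κ₀ + 1)) * C) * ((Lc : ℝ) ^ (5 * (k + 2)))⁻¹) * ((8 * (Lc : ℝ) + F * (1 + 8 * (Lc : ℝ) * (Real.exp κ₀ + 1))) * (c * θ ^ k) * ((Lc : ℝ) ^ (5 * (k + 2)))⁻¹) * (Lc : ℝ) ^ (k + 2) * (2 * (((Lc ^ (k + 2) : ℕ) : ℝ) * (Φ₀ * ((Lc : ℝ) ^ (8 * (k + 2)))⁻¹) * Real.exp κ₀) + (Φ₀ * ((Lc : ℝ) ^ (8 * (k + 2)))⁻¹) * (Lc : ℝ) ^ (k + 2)))) * (((((Lc ^ (k + 2) : ℕ) : ℝ)) ^ (3 + 1)) * Zl (3 + 1) (κ₀ / (4 * (((3 : ℕ) : ℝ) + 1))) * Real.exp (-(κ₀ / 12) * (supNorm (z₁ - zt) + supNorm (z₂ - zt))))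
          + (8 * Real.exp (5 * κ₀) * ((8 * (Lc : ℝ) * C + F * (1 + 8 * (Lc : ℝ) * (Real.exp κ₀ + 1)) * C) * ((Lc : ℝ) ^ (5 * (k + 1)))⁻¹) * ((8 * (Lc : ℝ) * C + F * (1 + 8 * (Lc : ℝ) * (Real.exp κ₀ + 1)) * C) * ((Lc : ℝ) ^ (5 * (k + 1)))⁻¹) * (Lc : ℝ) ^ (k + 1) * (2 * (((Lc ^ (k + 1) : ℕ) : ℝ) * ((cT * θK ^ k) * ((Lc : ℝ) ^ 4 * ((Lc : ℝ) ^ (k + 2)) ^ 8)⁻¹) * Real.exp κ₀) + ((cT * θK ^ k) * ((Lc : ℝ) ^ 4 * ((Lc : ℝ) ^ (k + 2)) ^ 8)⁻¹) * (Lc : ℝ) ^ (k + 1))) * (((((Lc ^ (k + 1) : ℕ) : ℝ)) ^ (3 + 1)) * Zl (3 + 1) (κ₀ / (4 * (((3 : ℕ) : ℝ) + 1))) * Real.exp (-(κ₀ / 12) * (supNorm (z₁ - zt) + supNorm (z₂ - zt)))))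
      = ((Lc : ℝ) ^ (12 * (k + 2)) * ((((((k + 2 : ℕ) : ℝ)) + 1) * (2 * Real.exp (2 * κ₀) * (((Lc ^ (k + 2) : ℕ) : ℝ) * (Φ₀ * ((Lc : ℝ) ^ (8 * (k + 2)))⁻¹) * Real.exp κ₀) * ((8 * (Lc : ℝ) * C + F * (1 + 8 * (Lc : ℝ) * (Real.exp κ₀ + 1)) * C) * ((Lc : ℝ) ^ (5 * (k + 2)))⁻¹) * ((8 * (Lc : ℝ) * C + F * (1 + 8 * (Lc : ℝ) * (Real.exp κ₀ + 1)) * C) * ((Lc : ℝ) ^ (5 * (k + 2)))⁻¹)) + ((((k + 2 : ℕ) : ℝ)) + 1) * (2 * Real.exp (5 * κ₀) * ((Φ₀ * ((Lc : ℝ) ^ (8 * (k + 2)))⁻¹) + (((Lc ^ (k + 2) : ℕ) : ℝ) * (Φ₀ * ((Lc : ℝ) ^ (8 * (k + 2)))⁻¹) * Real.exp κ₀)) * ((8 * (Lc : ℝ) * C + F * (1 + 8 * (Lc : ℝ) * (Real.exp κ₀ + 1)) * C) * ((Lc : ℝ) ^ (5 * (k + 2)))⁻¹) * ((8 * (Lc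 : ℝ) * C + F * (1 + 8 * (Lc : ℝ) * (Real.exp κ₀ + 1)) * C) * ((Lc : ℝ) ^ (5 * (k + 2)))⁻¹))
          + 8 * Real.exp (5 * κ₀) * ((8 * (Lc : ℝ) + F * (1 + 8 * (Lc : ℝ) * (Real.exp κ₀ + 1))) * (c * θ ^ k) * ((Lc : ℝ) ^ (5 * (k + 2)))⁻¹) * ((8 * (Lc : ℝ) * C + F * (1 + 8 * (Lc : ℝ) * (Real.exp κ₀ + 1)) * C) * ((Lc : ℝ) ^ (5 * (k + 2)))⁻¹) * (Lc : ℝ) ^ (k + 2) * (2 * (((Lc ^ (k + 2) : ℕ) : ℝ) * (Φ₀ * ((Lc : ℝ) ^ (8 * (k + 2)))⁻¹) * Real.exp κ₀) + (Φ₀ * ((Lc : ℝ) ^ (8 * (k + 2)))⁻¹) * (Lc : ℝ) ^ (k + 2)))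
        + (2 * Real.exp (5 * κ₀) * ((8 * (Lc : ℝ) * C + F * (1 + 8 * (Lc : ℝ) * (Real.exp κ₀ + 1)) * C) * ((Lc : ℝ) ^ (5 * (k + 2)))⁻¹) * ((8 * (Lc : ℝ) * C + F * (1 + 8 * (Lc : ℝ) * (Real.exp κ₀ + 1)) * C) * ((Lc : ℝ) ^ (5 * (k + 2)))⁻¹) * (((((k + 2 : ℕ) : ℝ)) + 1) * (((Lc ^ (k + 2) : ℕ) : ℝ) * (Φ₀ * ((Lc : ℝ) ^ (8 * (k + 2)))⁻¹) * Real.exp κ₀) + 2 * (Φ₀ * ((Lc : ℝ) ^ (8 * (k + 2)))⁻¹) * (Lc : ℝ) ^ (k + 2))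
          + 2 * Real.exp (5 * κ₀) * ((8 * (Lc : ℝ) * C + F * (1 + 8 * (Lc : ℝ) * (Real.exp κ₀ + 1)) * C) * ((Lc : ℝ) ^ (5 * (k + 2)))⁻¹) * ((8 * (Lc : ℝ) * C + F * (1 + 8 * (Lc : ℝ) * (Real.exp κ₀ + 1)) * C) * ((Lc : ℝ) ^ (5 * (k + 2)))⁻¹) * (((((k + 2 : ℕ) : ℝ)) + 1) * (((Lc ^ (k + 2) : ℕ) : ℝ) * (Φ₀ * ((Lc : ℝ) ^ (8 * (k + 2)))⁻¹) * Real.exp κ₀) + 2 * (Φ₀ * ((Lc : ℝ) ^ (8 * (k + 2)))⁻¹) * (Lc : ℝ) ^ (k + 2))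
          + 8 * Real.exp (5 * κ₀) * ((8 * (Lc : ℝ) * C + F * (1 + 8 * (Lc : ℝ) * (Real.exp κ₀ + 1)) * C) * ((Lc : ℝ) ^ (5 * (k + 2)))⁻¹) * ((8 * (Lc : ℝ) + F * (1 + 8 * (Lc : ℝ) * (Real.exp κ₀ + 1))) * (c * θ ^ k) * ((Lc : ℝ) ^ (5 * (k + 2)))⁻¹) * (Lc : ℝ) ^ (k + 2) * (2 * (((Lc ^ (k + 2) : ℕ) : ℝ) * (Φ₀ * ((Lc : ℝ) ^ (8 * (k + 2)))⁻¹) * Real.exp κ₀) + (Φ₀ * ((Lc : ℝ) ^ (8 * (k + 2)))⁻¹) * (Lc : ℝ) ^ (k + 2)))) * ((((Lc ^ (k + 2) : ℕ) : ℝ)) ^ (3 + 1))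
      + (Lc : ℝ) ^ (12 * (k + 2)) * (8 * Real.exp (5 * κ₀) * ((8 * (Lc : ℝ) * C + F * (1 + 8 * (Lc : ℝ) * (Real.exp κ₀ + 1)) * C) * ((Lc : ℝ) ^ (5 * (k + 1)))⁻¹) * ((8 * (Lc : ℝ) * C + F * (1 + 8 * (Lc : ℝ) * (Real.exp κ₀ + 1)) * C) * ((Lc : ℝ) ^ (5 * (k + 1)))⁻¹) * (Lc : ℝ) ^ (k + 1) * (2 * (((Lc ^ (k + 1) : ℕ) : ℝ) * ((cT * θK ^ k) * ((Lc : ℝ) ^ 4 * ((Lc : ℝ) ^ (k + 2)) ^ 8)⁻¹) * Real.exp κ₀) + ((cT * θK ^ k) * ((Lc : ℝ) ^ 4 * ((Lc : ℝ) ^ (k + 2)) ^ 8)⁻¹) * (Lc : ℝ) ^ (k + 1))) * ((((Lc ^ (k + 1) : ℕ) : ℝ)) ^ (3 + 1))) * (Zl (3 + 1) (κ₀ / (4 * (((3 : ℕ) : ℝ) + 1))) * Real.exp (-(κ₀ / 12) * (supNorm (z₁ - zt) + supNorm (z₂ - zt)))) := by ring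
    _ ≤ ((2 * (Φ₀ * (8 * (Lc : ℝ) * C + F * (1 + 8 * (Lc : ℝ) * (Real.exp κ₀ + 1)) * C) ^ 2 * (2 * (Real.exp (2 * κ₀) * Real.exp κ₀) + 6 * (Real.exp (5 * κ₀) * Real.exp κ₀))) + 2 * (2 * Real.exp (5 * κ₀) * Φ₀ * (8 * (Lc : ℝ) * C + F * (1 + 8 * (Lc : ℝ) * (Real.exp κ₀ + 1)) * C) ^ 2) + 2 * (8 * Real.exp (5 * κ₀) * Φ₀ * (8 * (Lc : ℝ) * C + F * (1 + 8 * (Lc : ℝ) * (Real.exp κ₀ + 1)) * C) ^ 2) + (16 * Real.exp (5 * κ₀) * (2 * Real.exp κ₀ + 1) * Φ₀ * (8 * (Lc : ℝ) * C + F * (1 + 8 * (Lc : ℝ) * (Real.exp κ₀ + 1)) * C) * ((8 * (Lc : ℝ) + F * (1 + 8 * (Lc : ℝ) * (Real.exp κ₀ + 1))) * c)) + (8 * Real.exp (5 * κ₀) * (2 * Real.exp κ₀ + 1) * cT * (8 * (Lc : ℝ) * C + F * (1 + 8 * (Lc : ℝ) * (Real.exp κ₀ + 1)) * C) ^ 2))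 * max θ (max θK ((3 : ℝ) / (2 * Lc))) ^ k) * (Zl (3 + 1) (κ₀ / (4 * (((3 : ℕ) : ℝ) + 1))) * Real.exp (-(κ₀ / 12) * (supNorm (z₁ - zt) + supNorm (z₂ - zt)))) :=
        mul_le_mul_of_nonneg_right hcount (mul_nonneg hZ0 hE0)
    _ = (2 * (Φ₀ * (8 * (Lc : ℝ) * C + F * (1 + 8 * (Lc : ℝ) * (Real.exp κ₀ + 1)) * C) ^ 2 * (2 * (Real.exp (2 * κ₀) * Real.exp κ₀) + 6 * (Real.exp (5 * κ₀) * Real.exp κ₀))) + 2 * (2 * Real.exp (5 * κ₀) * Φ₀ * (8 * (Lc : ℝ) * C + F * (1 + 8 * (Lc : ℝ) * (Real.exp κ₀ + 1)) * C) ^ 2) + 2 * (8 * Real.exp (5 * κ₀) * Φ₀ * (8 * (Lc : ℝ) * C + F * (1 + 8 * (Lc : ℝ) * (Real.exp κ₀ + 1)) * C) ^ 2) + (16 * Real.exp (5 * κ₀) * (2 * Real.exp κ₀ + 1) * Φ₀ * (8 * (Lc : ℝ) * C + F * (1 + 8 * (Lc : ℝ) * (Real.exp κ₀ + 1)) * C)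 * ((8 * (Lc : ℝ) + F * (1 + 8 * (Lc : ℝ) * (Real.exp κ₀ + 1))) * c)) + (8 * Real.exp (5 * κ₀) * (2 * Real.exp κ₀ + 1) * cT * (8 * (Lc : ℝ) * C + F * (1 + 8 * (Lc : ℝ) * (Real.exp κ₀ + 1)) * C) ^ 2)) * Zl (3 + 1) (κ₀ / (4 * (((3 : ℕ) : ℝ) + 1))) * max θ (max θK ((3 : ℝ) / (2 * Lc))) ^ k * Real.exp (-(κ₀ / 12) * (supNorm (z₁ - zt) + supNorm (z₂ - zt))) := by ring

/-- NOT IN PRINT; OUR BOOKKEEPING.  **THE TIP READING** (`θ = (0,1)`): `exists_pairingAtom_refine_three` with the summands rewritten by `ring`. -/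
theorem exists_pairingAtomTip_refine_three (hLc : 2 ≤ Lc) :
    ∃ κ₀ K θP : ℝ, 0 < κ₀ ∧ 0 ≤ K ∧ 0 ≤ θP ∧ θP < 1 ∧
      ∀ (r : Fin (3 + 1) → ℕ), r ∈ box (3 + 1) Lc → ∀ (rr : Fin (3 + 1) → ℕ), rr ∈ box (3 + 1) Lc →
        ∀ (k : ℕ) (μt : Fin (3 + 1)) (zt : Site (3 + 1)) (μ₁ : Fin (3 + 1)) (z₁ : Site (3 + 1)) (μ₂ : Fin (3 + 1)) (z₂ : Site (3 + 1))
          (κ : Fin (3 + 1)),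
          |(Lc : ℝ) ^ (12 * (k + 2)) * (∑' v : Site (3 + 1), contourSumAdj (Lc ^ (k + 2)) (fun κ' y => wΦ (N := Lc ^ (k + 2)) κ' μt (y - zt)) κ v
            * (Psi (toSite rr) Lc 0 (k + 1) (delta1 μ₁ z₁) (v + unitVec κ) + PsiFace r (toSite rr) Lc 0 (k + 1) (delta1 μ₁ z₁) (v + unitVec κ) - bmGaugeAt (toSite rr) (respStep (d := 3) 1 (Lc ^ (k + 2)) μ₁ z₁) Lc (v + unitVec κ))
            * ((Psi (toSite rr) Lc 0 (k + 1) (delta1 μ₂ z₂) (v + unitVec κ) + PsiFace r (toSite rr) Lc 0 (k + 1) (delta1 μ₂ z₂) (v + unitVec κ) - bmGaugeAt (toSite rr) (respStep (d := 3) 1 (Lc ^ (k + 2)) μ₂ z₂) Lc (v + unitVec κ))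
              - (Psi (toSite rr) Lc 0 (k + 1) (delta1 μ₂ z₂) v + PsiFace r (toSite rr) Lc 0 (k + 1) (delta1 μ₂ z₂) v - bmGaugeAt (toSite rr) (respStep (d := 3) 1 (Lc ^ (k + 2)) μ₂ z₂) Lc v)))
            - (Lc : ℝ) ^ (12 * (k + 1)) * (∑' w : Site (3 + 1), contourSumAdj (Lc ^ (k + 1)) (fun κ' y => wΦ (N := Lc ^ (k + 1)) κ' μt (y - zt)) κ w
            * (Psi (toSite rr) Lc 0 k (delta1 μ₁ z₁) (w + unitVec κ) + PsiFace r (toSite rr) Lc 0 k (delta1 μ₁ z₁) (w + unitVec κ) - bmGaugeAt (toSite rr) (respStep (d := 3) 1 (Lc ^ (k + 1)) μ₁ z₁) Lc (w + unitVec κ))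
            * ((Psi (toSite rr) Lc 0 k (delta1 μ₂ z₂) (w + unitVec κ) + PsiFace r (toSite rr) Lc 0 k (delta1 μ₂ z₂) (w + unitVec κ) - bmGaugeAt (toSite rr) (respStep (d := 3) 1 (Lc ^ (k + 1)) μ₂ z₂) Lc (w + unitVec κ))
              - (Psi (toSite rr) Lc 0 k (delta1 μ₂ z₂) w + PsiFace r (toSite rr) Lc 0 k (delta1 μ₂ z₂) w - bmGaugeAt (toSite rr) (respStep (d := 3) 1 (Lc ^ (k + 1)) μ₂ z₂) Lc w)))|
            ≤ K * θP ^ k * Real.exp (-(κ₀ / 12) * (supNorm (z₁ - zt) + supNorm (z₂ - zt))) := by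
  obtain ⟨κ₀, K, θP, hκ, hK, hθP0, hθP1, h⟩ := exists_pairingAtom_refine_three (Lc := Lc) hLc
  refine ⟨κ₀, K, θP, hκ, hK, hθP0, hθP1, fun r hr rr hrr k μt zt μ₁ z₁ μ₂ z₂ κ => ?_⟩
  have hθr : |(0 : ℝ)| + |(1 : ℝ)| ≤ 1 := by norm_num
  have h' := h r hr rr hrr k μt zt μ₁ z₁ μ₂ z₂ 0 1 hθr κ
  have e1 : (∑' v : Site (3 + 1), contourSumAdj (Lc ^ (k + 2)) (fun κ' y => wΦ (N := Lc ^ (k + 2)) κ' μt (y - zt)) κ v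
            * (0 * (Psi (toSite rr) Lc 0 (k + 1) (delta1 μ₁ z₁) v + PsiFace r (toSite rr) Lc 0 (k + 1) (delta1 μ₁ z₁) v - bmGaugeAt (toSite rr) (respStep (d := 3) 1 (Lc ^ (k + 2)) μ₁ z₁) Lc v)
              + 1 * (Psi (toSite rr) Lc 0 (k + 1) (delta1 μ₁ z₁) (v + unitVec κ) + PsiFace r (toSite rr) Lc 0 (k + 1) (delta1 μ₁ z₁) (v + unitVec κ) - bmGaugeAt (toSite rr) (respStep (d := 3) 1 (Lc ^ (k + 2)) μ₁ z₁) Lc (v + unitVec κ)))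
            * ((Psi (toSite rr) Lc 0 (k + 1) (delta1 μ₂ z₂) (v + unitVec κ) + PsiFace r (toSite rr) Lc 0 (k + 1) (delta1 μ₂ z₂) (v + unitVec κ) - bmGaugeAt (toSite rr) (respStep (d := 3) 1 (Lc ^ (k + 2)) μ₂ z₂) Lc (v + unitVec κ))
              - (Psi (toSite rr) Lc 0 (k + 1) (delta1 μ₂ z₂) v + PsiFace r (toSite rr) Lc 0 (k + 1) (delta1 μ₂ z₂) v - bmGaugeAt (toSite rr) (respStep (d := 3) 1 (Lc ^ (k + 2)) μ₂ z₂) Lc v)))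
      = ∑' v : Site (3 + 1), contourSumAdj (Lc ^ (k + 2)) (fun κ' y => wΦ (N := Lc ^ (k + 2)) κ' μt (y - zt)) κ v
            * (Psi (toSite rr) Lc 0 (k + 1) (delta1 μ₁ z₁) (v + unitVec κ) + PsiFace r (toSite rr) Lc 0 (k + 1) (delta1 μ₁ z₁) (v + unitVec κ) - bmGaugeAt (toSite rr) (respStep (d := 3) 1 (Lc ^ (k + 2)) μ₁ z₁) Lc (v + unitVec κ))
            * ((Psi (toSite rr) Lc 0 (k + 1) (delta1 μ₂ z₂) (v + unitVec κ) + PsiFace r (toSite rr) Lc 0 (k + 1) (delta1 μ₂ z₂) (v + unitVec κ) - bmGaugeAt (toSite rr) (respStep (d := 3) 1 (Lc ^ (k + 2)) μ₂ z₂) Lc (v + unitVec κ))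
              - (Psi (toSite rr) Lc 0 (k + 1) (delta1 μ₂ z₂) v + PsiFace r (toSite rr) Lc 0 (k + 1) (delta1 μ₂ z₂) v - bmGaugeAt (toSite rr) (respStep (d := 3) 1 (Lc ^ (k + 2)) μ₂ z₂) Lc v)) := tsum_congr fun v => by ring
  have e0 : (∑' w : Site (3 + 1), contourSumAdj (Lc ^ (k + 1)) (fun κ' y => wΦ (N := Lc ^ (k + 1)) κ' μt (y - zt)) κ w
            * (0 * (Psi (toSite rr) Lc 0 k (delta1 μ₁ z₁) w + PsiFace r (toSite rr) Lc 0 k (delta1 μ₁ z₁) w - bmGaugeAt (toSite rr) (respStep (d := 3) 1 (Lc ^ (k + 1)) μ₁ z₁) Lc w)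
              + 1 * (Psi (toSite rr) Lc 0 k (delta1 μ₁ z₁) (w + unitVec κ) + PsiFace r (toSite rr) Lc 0 k (delta1 μ₁ z₁) (w + unitVec κ) - bmGaugeAt (toSite rr) (respStep (d := 3) 1 (Lc ^ (k + 1)) μ₁ z₁) Lc (w + unitVec κ)))
            * ((Psi (toSite rr) Lc 0 k (delta1 μ₂ z₂) (w + unitVec κ) + PsiFace r (toSite rr) Lc 0 k (delta1 μ₂ z₂) (w + unitVec κ) - bmGaugeAt (toSite rr) (respStep (d := 3) 1 (Lc ^ (k + 1)) μ₂ z₂) Lc (w + unitVec κ))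
              - (Psi (toSite rr) Lc 0 k (delta1 μ₂ z₂) w + PsiFace r (toSite rr) Lc 0 k (delta1 μ₂ z₂) w - bmGaugeAt (toSite rr) (respStep (d := 3) 1 (Lc ^ (k + 1)) μ₂ z₂) Lc w)))
      = ∑' w : Site (3 + 1), contourSumAdj (Lc ^ (k + 1)) (fun κ' y => wΦ (N := Lc ^ (k + 1)) κ' μt (y - zt)) κ w
            * (Psi (toSite rr) Lc 0 k (delta1 μ₁ z₁) (w + unitVec κ) + PsiFace r (toSite rr) Lc 0 k (delta1 μ₁ z₁) (w + unitVec κ) - bmGaugeAt (toSite rr) (respStep (d := 3) 1 (Lc ^ (k + 1)) μ₁ z₁) Lc (w + unitVec κ))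
            * ((Psi (toSite rr) Lc 0 k (delta1 μ₂ z₂) (w + unitVec κ) + PsiFace r (toSite rr) Lc 0 k (delta1 μ₂ z₂) (w + unitVec κ) - bmGaugeAt (toSite rr) (respStep (d := 3) 1 (Lc ^ (k + 1)) μ₂ z₂) Lc (w + unitVec κ))
              - (Psi (toSite rr) Lc 0 k (delta1 μ₂ z₂) w + PsiFace r (toSite rr) Lc 0 k (delta1 μ₂ z₂) w - bmGaugeAt (toSite rr) (respStep (d := 3) 1 (Lc ^ (k + 1)) μ₂ z₂) Lc w)) := tsum_congr fun w => by ring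
  rw [e1, e0] at h'
  exact h'

/-- NOT IN PRINT; OUR BOOKKEEPING.  **THE MIDPOINT READING** (`(ψ u + ψ (u+e_κ))∕2`: the owner's `StaircasePairing.abs_pairing_le_sum` slot after `ContactCellSplit.split_mid`) — `exists_pairingAtom_refine_three` at `θ = (½,½)`, summands rewritten by `ring`. -/
theorem exists_pairingAtomMid_refine_three (hLc : 2 ≤ Lc) :
    ∃ κ₀ K θP : ℝ, 0 < κ₀ ∧ 0 ≤ K ∧ 0 ≤ θP ∧ θP < 1 ∧
      ∀ (r : Fin (3 + 1) → ℕ), r ∈ box (3 + 1) Lc → ∀ (rr : Fin (3 + 1) → ℕ), rr ∈ box (3 + 1) Lc →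
        ∀ (k : ℕ) (μt : Fin (3 + 1)) (zt : Site (3 + 1)) (μ₁ : Fin (3 + 1)) (z₁ : Site (3 + 1)) (μ₂ : Fin (3 + 1)) (z₂ : Site (3 + 1))
          (κ : Fin (3 + 1)),
          |(Lc : ℝ) ^ (12 * (k + 2)) * (∑' v : Site (3 + 1), contourSumAdj (Lc ^ (k + 2)) (fun κ' y => wΦ (N := Lc ^ (k + 2)) κ' μt (y - zt)) κ v
            * (((Psi (toSite rr) Lc 0 (k + 1) (delta1 μ₁ z₁) v + PsiFace r (toSite rr) Lc 0 (k + 1) (delta1 μ₁ z₁) v - bmGaugeAt (toSite rr) (respStep (d := 3) 1 (Lc ^ (k + 2)) μ₁ z₁) Lc v)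
              + (Psi (toSite rr) Lc 0 (k + 1) (delta1 μ₁ z₁) (v + unitVec κ) + PsiFace r (toSite rr) Lc 0 (k + 1) (delta1 μ₁ z₁) (v + unitVec κ) - bmGaugeAt (toSite rr) (respStep (d := 3) 1 (Lc ^ (k + 2)) μ₁ z₁) Lc (v + unitVec κ))) / 2)
            * ((Psi (toSite rr) Lc 0 (k + 1) (delta1 μ₂ z₂) (v + unitVec κ) + PsiFace r (toSite rr) Lc 0 (k + 1) (delta1 μ₂ z₂) (v + unitVec κ) - bmGaugeAt (toSite rr) (respStep (d := 3) 1 (Lc ^ (k + 2)) μ₂ z₂) Lc (v + unitVec κ))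
              - (Psi (toSite rr) Lc 0 (k + 1) (delta1 μ₂ z₂) v + PsiFace r (toSite rr) Lc 0 (k + 1) (delta1 μ₂ z₂) v - bmGaugeAt (toSite rr) (respStep (d := 3) 1 (Lc ^ (k + 2)) μ₂ z₂) Lc v)))
            - (Lc : ℝ) ^ (12 * (k + 1)) * (∑' w : Site (3 + 1), contourSumAdj (Lc ^ (k + 1)) (fun κ' y => wΦ (N := Lc ^ (k + 1)) κ' μt (y - zt)) κ w
            * (((Psi (toSite rr) Lc 0 k (delta1 μ₁ z₁) w + PsiFace r (toSite rr) Lc 0 k (delta1 μ₁ z₁) w - bmGaugeAt (toSite rr) (respStep (d := 3) 1 (Lc ^ (k + 1)) μ₁ z₁) Lc w)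
              + (Psi (toSite rr) Lc 0 k (delta1 μ₁ z₁) (w + unitVec κ) + PsiFace r (toSite rr) Lc 0 k (delta1 μ₁ z₁) (w + unitVec κ) - bmGaugeAt (toSite rr) (respStep (d := 3) 1 (Lc ^ (k + 1)) μ₁ z₁) Lc (w + unitVec κ))) / 2)
            * ((Psi (toSite rr) Lc 0 k (delta1 μ₂ z₂) (w + unitVec κ) + PsiFace r (toSite rr) Lc 0 k (delta1 μ₂ z₂) (w + unitVec κ) - bmGaugeAt (toSite rr) (respStep (d := 3) 1 (Lc ^ (k + 1)) μ₂ z₂) Lc (w + unitVec κ))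
              - (Psi (toSite rr) Lc 0 k (delta1 μ₂ z₂) w + PsiFace r (toSite rr) Lc 0 k (delta1 μ₂ z₂) w - bmGaugeAt (toSite rr) (respStep (d := 3) 1 (Lc ^ (k + 1)) μ₂ z₂) Lc w)))|
            ≤ K * θP ^ k * Real.exp (-(κ₀ / 12) * (supNorm (z₁ - zt) + supNorm (z₂ - zt))) := by
  obtain ⟨κ₀, K, θP, hκ, hK, hθP0, hθP1, h⟩ := exists_pairingAtom_refine_three (Lc := Lc) hLc
  refine ⟨κ₀, K, θP, hκ, hK, hθP0, hθP1, fun r hr rr hrr k μt zt μ₁ z₁ μ₂ z₂ κ => ?_⟩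
  have hθr : |(1 / 2 : ℝ)| + |(1 / 2 : ℝ)| ≤ 1 := by norm_num
  have h' := h r hr rr hrr k μt zt μ₁ z₁ μ₂ z₂ (1 / 2) (1 / 2) hθr κ
  have e1 : (∑' v : Site (3 + 1), contourSumAdj (Lc ^ (k + 2)) (fun κ' y => wΦ (N := Lc ^ (k + 2)) κ' μt (y - zt)) κ v
            * ((1 / 2 : ℝ) * (Psi (toSite rr) Lc 0 (k + 1) (delta1 μ₁ z₁) v + PsiFace r (toSite rr) Lc 0 (k + 1) (delta1 μ₁ z₁) v - bmGaugeAt (toSite rr) (respStep (d := 3) 1 (Lc ^ (k + 2)) μ₁ z₁) Lc v)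
              + (1 / 2 : ℝ) * (Psi (toSite rr) Lc 0 (k + 1) (delta1 μ₁ z₁) (v + unitVec κ) + PsiFace r (toSite rr) Lc 0 (k + 1) (delta1 μ₁ z₁) (v + unitVec κ) - bmGaugeAt (toSite rr) (respStep (d := 3) 1 (Lc ^ (k + 2)) μ₁ z₁) Lc (v + unitVec κ)))
            * ((Psi (toSite rr) Lc 0 (k + 1) (delta1 μ₂ z₂) (v + unitVec κ) + PsiFace r (toSite rr) Lc 0 (k + 1) (delta1 μ₂ z₂) (v + unitVec κ) - bmGaugeAt (toSite rr) (respStep (d := 3) 1 (Lc ^ (k + 2)) μ₂ z₂) Lc (v + unitVec κ))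
              - (Psi (toSite rr) Lc 0 (k + 1) (delta1 μ₂ z₂) v + PsiFace r (toSite rr) Lc 0 (k + 1) (delta1 μ₂ z₂) v - bmGaugeAt (toSite rr) (respStep (d := 3) 1 (Lc ^ (k + 2)) μ₂ z₂) Lc v)))
      = ∑' v : Site (3 + 1), contourSumAdj (Lc ^ (k + 2)) (fun κ' y => wΦ (N := Lc ^ (k + 2)) κ' μt (y - zt)) κ v
            * (((Psi (toSite rr) Lc 0 (k + 1) (delta1 μ₁ z₁) v + PsiFace r (toSite rr) Lc 0 (k + 1) (delta1 μ₁ z₁) v - bmGaugeAt (toSite rr) (respStep (d := 3) 1 (Lc ^ (k + 2)) μ₁ z₁) Lc v)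
              + (Psi (toSite rr) Lc 0 (k + 1) (delta1 μ₁ z₁) (v + unitVec κ) + PsiFace r (toSite rr) Lc 0 (k + 1) (delta1 μ₁ z₁) (v + unitVec κ) - bmGaugeAt (toSite rr) (respStep (d := 3) 1 (Lc ^ (k + 2)) μ₁ z₁) Lc (v + unitVec κ))) / 2)
            * ((Psi (toSite rr) Lc 0 (k + 1) (delta1 μ₂ z₂) (v + unitVec κ) + PsiFace r (toSite rr) Lc 0 (k + 1) (delta1 μ₂ z₂) (v + unitVec κ) - bmGaugeAt (toSite rr) (respStep (d := 3) 1 (Lc ^ (k + 2)) μ₂ z₂) Lc (v + unitVec κ))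
              - (Psi (toSite rr) Lc 0 (k + 1) (delta1 μ₂ z₂) v + PsiFace r (toSite rr) Lc 0 (k + 1) (delta1 μ₂ z₂) v - bmGaugeAt (toSite rr) (respStep (d := 3) 1 (Lc ^ (k + 2)) μ₂ z₂) Lc v)) := tsum_congr fun v => by ring
  have e0 : (∑' w : Site (3 + 1), contourSumAdj (Lc ^ (k + 1)) (fun κ' y => wΦ (N := Lc ^ (k + 1)) κ' μt (y - zt)) κ w
            * ((1 / 2 : ℝ) * (Psi (toSite rr) Lc 0 k (delta1 μ₁ z₁) w + PsiFace r (toSite rr) Lc 0 k (delta1 μ₁ z₁) w - bmGaugeAt (toSite rr) (respStep (d := 3) 1 (Lc ^ (k + 1)) μ₁ z₁) Lc w)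
              + (1 / 2 : ℝ) * (Psi (toSite rr) Lc 0 k (delta1 μ₁ z₁) (w + unitVec κ) + PsiFace r (toSite rr) Lc 0 k (delta1 μ₁ z₁) (w + unitVec κ) - bmGaugeAt (toSite rr) (respStep (d := 3) 1 (Lc ^ (k + 1)) μ₁ z₁) Lc (w + unitVec κ)))
            * ((Psi (toSite rr) Lc 0 k (delta1 μ₂ z₂) (w + unitVec κ) + PsiFace r (toSite rr) Lc 0 k (delta1 μ₂ z₂) (w + unitVec κ) - bmGaugeAt (toSite rr) (respStep (d := 3) 1 (Lc ^ (k + 1)) μ₂ z₂) Lc (w + unitVec κ))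
              - (Psi (toSite rr) Lc 0 k (delta1 μ₂ z₂) w + PsiFace r (toSite rr) Lc 0 k (delta1 μ₂ z₂) w - bmGaugeAt (toSite rr) (respStep (d := 3) 1 (Lc ^ (k + 1)) μ₂ z₂) Lc w)))
      = ∑' w : Site (3 + 1), contourSumAdj (Lc ^ (k + 1)) (fun κ' y => wΦ (N := Lc ^ (k + 1)) κ' μt (y - zt)) κ w
            * (((Psi (toSite rr) Lc 0 k (delta1 μ₁ z₁) w + PsiFace r (toSite rr) Lc 0 k (delta1 μ₁ z₁) w - bmGaugeAt (toSite rr) (respStep (d := 3) 1 (Lc ^ (k + 1)) μ₁ z₁) Lc w)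
              + (Psi (toSite rr) Lc 0 k (delta1 μ₁ z₁) (w + unitVec κ) + PsiFace r (toSite rr) Lc 0 k (delta1 μ₁ z₁) (w + unitVec κ) - bmGaugeAt (toSite rr) (respStep (d := 3) 1 (Lc ^ (k + 1)) μ₁ z₁) Lc (w + unitVec κ))) / 2)
            * ((Psi (toSite rr) Lc 0 k (delta1 μ₂ z₂) (w + unitVec κ) + PsiFace r (toSite rr) Lc 0 k (delta1 μ₂ z₂) (w + unitVec κ) - bmGaugeAt (toSite rr) (respStep (d := 3) 1 (Lc ^ (k + 1)) μ₂ z₂) Lc (w + unitVec κ))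
              - (Psi (toSite rr) Lc 0 k (delta1 μ₂ z₂) w + PsiFace r (toSite rr) Lc 0 k (delta1 μ₂ z₂) w - bmGaugeAt (toSite rr) (respStep (d := 3) 1 (Lc ^ (k + 1)) μ₂ z₂) Lc w)) := tsum_congr fun w => by ring
  rw [e1, e0] at h'
  exact h'

end Summit.QuantumFields.BalabanUV.Beta.GAN24.CombContactRefinePThreePack

end
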